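import Summits.BirchSwinnertonDyer.BirchSwinnertonDyer.Theses.PrintX8VSC
import HarnessLib

/-!
# Route `PrintX8VSC` (the print-keyed repair twin of `PrintX8VS`, director-bsd (267)(B)/(288)(a); born 2026-08-28T22:36Z),
# item stmt-BirchSwinnertonDyer-23746 `Assembly` — PROVED (the x8 planner's `assembly_holds`, package twinC-g33 v2.1
# `Sketch.lean`, against the born route file)

Cell `bsd-ssimc`, width seat `cruxlead-stmt-BirchSwinnertonDyer-19875-w3` (gen 10) under the 19875 LEAD, on the lane split agreed on the
host bus 2026-08-28T22:39Z–22:4xZ (w2 g11: glue 23743; this seat: 23744 + 23746). HONEST FRAMING: pure plumbing, no mathematics —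
the assembly composes the route's own items: the glue gives the print-keyed ♯/♭ main conjecture `SharpFlatMainConjectureX8Contra` from
the two residual cruxes K′ (23732), C′ (23733), the held inputs, SPAN and the published bundle; the two links turn it into Miller's
missing `p`-part at analytic rank `0` resp. `1`; Gross–Zagier–Kolyvagin bookkeeping (`Typed.bsdp_of_missingPPartAt`) gives `BSD(E,3)`
at every X8 pair of analytic rank `≤ 1`, i.e. the leaf `WAllCornerX8`. K′, C′, the print-keyed main conjecture, the rank-one link's
BKO input, leaf X8 and BSD are NOT proved by this file; every antecedent stays a hypothesis of the implication.

References: route file `Theses/PrintX8VSC.lean` (rev 2); package `run/shared/lean/pub/bsd-print-x8/bsd-print-x8-plan/twinC-g33/Sketch.lean`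
(`assembly_holds`, farm rc 0); [Miller2011LMS] §1 and Def. 1.1; [GrossZagier1986]; [Kolyvagin1990]; [Sprung2012] Main Conj. 7.21.
-/

set_option autoImplicit false
-- justification: the mandated namespace `Summit.BirchSwinnertonDyer.BirchSwinnertonDyer.Theorems`
-- (single-conjunct summit, Sub = Summit) repeats a segment by design (D-0017).
set_option linter.dupNamespace false

namespace Summit.BirchSwinnertonDyer.BirchSwinnertonDyer.Theorems.PrintX8VSCGlue

open Literature
open Summit.BirchSwinnertonDyer.BirchSwinnertonDyer.Theses.PrintX8VSC

/-- **Item stmt-BirchSwinnertonDyer-23746 `PrintX8VSC.Assembly` holds**: K′ → C′ → held inputs → SPAN → published bundle → glue →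
rank-0 link → rank-1 link → GZK → the X8 leaf `WAllCornerX8`. Proof (the planner's `assembly_holds`, token for token): the glue yields
the print-keyed main conjecture `hMC`; the links give `Typed.MissingPPartAt` at analytic rank `0` / `1`; the rank split and
`Typed.bsdp_of_missingPPartAt` (GZK) conclude. Unconditional as an implication; closes the assembly item only.
[cite: Miller2011LMS, §1 and Def. 1.1] [cite: Sprung2012, Main Conj. 7.21 (p. 1505)] -/
theorem assembly_holds : Assembly := by
  intro hResK hResC hHeld hSpan hPub hGlueMC hLink0 hLink1 hGZK
  have hMC : SharpFlatMainConjectureX8Contra := hGlueMC hResK hResC hHeld hSpan hPub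
  have h0 := hLink0 hPub hGZK hMC
  have h1 := hLink1 hPub hGZK hMC
  unfold RankEqAnalyticRankLeOne at hGZK
  intro W _ _ p _ _ hX hr
  rcases Nat.le_one_iff_eq_zero_or_eq_one.mp hr with hr0 | hr1
  · exact NumberTheory.EllipticCurves.Rank1Residual.Typed.bsdp_of_missingPPartAt W p hGZK hr (h0 W p hX hr0)
  · exact NumberTheory.EllipticCurves.Rank1Residual.Typed.bsdp_of_missingPPartAt W p hGZK hr (h1 W p hX hr1)

end Summit.BirchSwinnertonDyer.BirchSwinnertonDyer.Theorems.PrintX8VSCGlue
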